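import Literature.AlgebraicGeometry.AbelianSchemes.FrobeniusVersusHeckeSerreTensorPolarization
import HarnessLib

/-!
# Polarised recognition along the relative Frobenius: `F ≫ e = φ`, `φ^*λ_C = M′·λ_A`, `M′ = pⁿ·M₂` ⇒ `e ≫ λ_C ≫ e^∨ = λ^{(q)} ≫ [M₂]`

Topic `Literature/AlgebraicGeometry/AbelianSchemes`, namespace `Literature.AlgebraicGeometry.AbelianSchemes.AbelianSchemeOver` (THEOREMS ONLY; no
definition, no named fact, no `sorry`, no `instance`, no notation).  Cell `hodgecm-mathlib`, F0/P6 «MOD», sequel to ★ (σ2-CORE-λ)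
`FrobeniusVersusHeckeSerreTensorPolarization` (E-form, via `ι(π₀)`) serving the `π₀`-FREE form of the σ2 spine (★ `SerreTranslateComposition` §2:
`e′ : A^{(q)} ≅ B ⊗ 𝔞⁻¹`, `F ≫ e′ = ρ′ ≫ χ`) and any other recognition `F ≫ e = φ` of the Frobenius twist (★ ST-2F-λ is the case `φ = ψ_P`); `--supports
stmt-HodgeConjecture-24832`, count-neutral.  HC_CM is proved only modulo the 2 remaining named inputs (hLiu418, h413) until rung 0 closes; this file
discharges none of them.

## Mathematics

`k` a field of exponential characteristic `p`, `q = pⁿ`, `A` an abelian variety over `k`, `F = F_{A/k,q} : A → A^{(q)}` (★ `relFrobeniusHom`), `C` an abelian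
`k`-scheme, `e : A^{(q)} ≅ C` a homomorphism and `φ : A → C` with **`F ≫ e = φ`**.  Fix dual pairs `(Â, 𝒫_A)`, `(Ĉ, 𝒫_C)` with the unit hypotheses and
homomorphisms `λ_A : A → Â`, `λ_C : C → Ĉ`.  If **`φ ≫ λ_C ≫ φ^∨ = λ_A ≫ [M′]`** with **`M′ = pⁿ·M₂`**, then **`e ≫ λ_C ≫ e^∨_{Â^{(q)},Ĉ} = λ_A^{(q)} ≫ [M₂]`**
(`λ_A^{(q)} = λ_A ×_k Frobⁿ`, ★ `baseChangeHom`): both sides pull back along the fppf cover `F` to `λ_A ≫ [pⁿ M₂]` (★ (DF-2)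
`relFrobeniusHom_comp_baseChangeHom_comp_dualIsogenyOver`, ★ `mulN_comp_mulN`), and `F^∨` is quasi-invertible through the Verschiebung (★
`exists_relFrobeniusHom_comp_eq_pow_id`, ★ `comp_relFrobeniusHom_eq_pow_id_of`), so ★ (λ) polarised recognition `comp_lam_comp_dualIsogenyOver_eq_of_pullback_eq`
applies.  In particular `M′ = pⁿ` gives an isomorphism of POLARISED abelian `k`-schemes `(A^{(q)}, λ^{(q)}) ≅ (C, λ_C)`.  §2 computes the pull-back scalar
for a two-step `φ = ρ′ ≫ χ` (`ρ′^*λ♭ = M₁·λ_A`, `χ^*λ_C = M₃·λ♭` ⇒ `φ^*λ_C = M₁M₃·λ_A`), the shape of the `π₀`-free σ2 spine (`ρ′` the Hecke datum, `χ` the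
Serre cover `B ⊗ 𝔭⁻¹ → B ⊗ 𝔞⁻¹`).  ([MumfordAV1970] §23; [RapoportSmithlingZhang2020Diagonal] (4.23) `p^{2δ}λ = φ^∨λ′φ`.)

## Contents

* §1 **`comp_lam_comp_dualIsogenyOver_eq_baseChangeHom_comp_mulN_of_relFrobeniusHom_comp_eq`** (the statement above, `k` perfect of characteristic `p`),
  `comp_lam_comp_dualIsogenyOver_eq_baseChangeHom_of_relFrobeniusHom_comp_eq` (`M′ = pⁿ`: exact).
* §2 `comp_comp_lam_comp_dualIsogenyOver_comp_eq` (`(ρ′ ≫ χ)^*λ_C = λ_A ≫ [M₁·M₃]`).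

## References
* [MumfordAV1970] D. Mumford, *Abelian Varieties* (1970), §15 Thm. 1 (p. 143), §23 (p. 231).
* [RapoportSmithlingZhang2020Diagonal] M. Rapoport, B. Smithling, W. Zhang (2020), §4.3 (p. 20), (4.23) (p. 21).
* [Shimura1998] G. Shimura, *Abelian Varieties with Complex Multiplication and Modular Functions* (1998), §13.1 Thm. 1 (pp. 97–99), §2.8 Prop. 6 (p. 16).
* [Liu2021] Y. Liu (2021), Prop. D.8 (3) (p. 135).
* Tree: ★ `FrobeniusVersusHeckeSerreTensorPolarization` (σ2-CORE-λ §1), ★ `AbelianSchemeHomDescentPolarized` (λ), ★ `SerreTensorFrobeniusTwistPolarization` §1,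
  ★ `DualIsogenyQuasiInverse`, ★ `AbelianSchemeDualIsogenyComp`, ★ `AbelianSchemeQuotientPolarizationPullbackDesc` (`mulN_comp_mulN`).
-/

noncomputable section

universe u

open CategoryTheory CategoryTheory.Limits AlgebraicGeometry MonoidalCategory CartesianMonoidalCategory
open scoped MonObj

namespace Literature.AlgebraicGeometry.AbelianSchemes

namespace AbelianSchemeOver

/-! ## §1 Polarised recognition along `F` with a scalar -/

section Recognition

open Literature.AlgebraicGeometry.Motives Literature.AlgebraicGeometry.Motives.AbelianVariety

variable {k : Type u} [Field k] [PerfectField k] (p : ℕ) [Fact p.Prime] [CharP k p] [ExpChar k p] (n : ℕ) {A : AbelianVariety k}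
  [IsMonHom (relFrobeniusHom p n A)]
  {C : AbelianSchemeOver (Spec (.of k))} (φ : (AbelianScheme.ofAbelianVariety A).toOver.X ⟶ C.X) [IsMonHom φ]
  (e : (AbelianScheme.ofAbelianVariety (A.frobeniusTwist p n)).toOver.X ≅ C.X) [IsMonHom e.hom]
  (DA : (AbelianScheme.ofAbelianVariety A).toOver.DualPair)
  (hDA : Nonempty ((Scheme.Modules.pullback (DualPair.unitHatSlice DA)).obj DA.P ≅ SheafOfModules.unit _))
  (lamA : (AbelianScheme.ofAbelianVariety A).toOver.X ⟶ DA.hat.X) [IsMonHom lamA]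
  (DC : C.DualPair) (hDC : Nonempty ((Scheme.Modules.pullback (DualPair.unitHatSlice DC)).obj DC.P ≅ SheafOfModules.unit _))
  (lamC : C.X ⟶ DC.hat.X) [IsMonHom lamC]

include hDA hDC

-- `A^{(q)}.X` vs `(A₀.baseChange Frobⁿ).X` (the carrier of ★ `baseChangeHom`) agree only semireducibly (as in ★ FROB₀-organ §3 ∕ ★ σ2-CORE-λ).
set_option backward.isDefEq.respectTransparency false in
/-- **POLARISED RECOGNITION ALONG THE RELATIVE FROBENIUS, WITH A SCALAR.**  `k` perfect of characteristic `p`, `F = F_{A/k,q}`, `e : A^{(q)} ≅ C` a homomorphism,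
`φ : A → C` a homomorphism with `F ≫ e = φ`; `λ_A : A → Â`, `λ_C : C → Ĉ` homomorphisms into dual abelian schemes (unit hypotheses).  If `φ ≫ λ_C ≫ φ^∨ = λ_A ≫ [M′]`
and `M′ = pⁿ·M₂`, then **`e ≫ λ_C ≫ e^∨ = λ_A^{(q)} ≫ [M₂]`** (both pull back along `F` to `λ_A ≫ [pⁿ·M₂]` — ★ (DF-2) and ★ `mulN_comp_mulN`; `F` is an fppf cover and
`F^∨` has the quasi-inverse `V^∨`, `V` the Verschiebung (★ `exists_relFrobeniusHom_comp_eq_pow_id`); ★ (λ) `comp_lam_comp_dualIsogenyOver_eq_of_pullback_eq`).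
[cite: MumfordAV1970, §23 (p. 231)] [cite: MumfordAV1970, §15 Thm. 1 (p. 143)] [cite: RapoportSmithlingZhang2020Diagonal, §4.3 (p. 20), (4.23) (p. 21)]
[cite: Shimura1998, §13.1 Thm. 1 (pp. 97–99)] -/
theorem comp_lam_comp_dualIsogenyOver_eq_baseChangeHom_comp_mulN_of_relFrobeniusHom_comp_eq (he : relFrobeniusHom p n A ≫ e.hom = φ)
    {M' M₂ : ℕ} (hφ : φ ≫ lamC ≫ DualPair.dualIsogenyOver φ DA DC = lamA ≫ DA.hat.mulN M') (hM' : M' = p ^ n * M₂) :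
    e.hom ≫ lamC ≫ DualPair.dualIsogenyOver e.hom (DA.frobeniusTwist p n A) DC =
      baseChangeHom (A := (AbelianScheme.ofAbelianVariety A).toOver) (B := DA.hat) lamA (frobSpec k p n) ≫ (DA.frobeniusTwist p n A).hat.mulN M₂ := by
  haveI := isFinite_relFrobeniusHom_left p n A
  haveI := flat_relFrobeniusHom_left p n A
  haveI := surjective_relFrobeniusHom_left p n A
  haveI := isMonHom_baseChangeHom (A := (AbelianScheme.ofAbelianVariety A).toOver) (B := DA.hat) lamA (frobSpec k p n)
  have hDq := DA.nonempty_unitHatSlice_frobeniusTwist_iso p n A hDA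
  haveI := DualPair.isMonHom_dualIsogenyOver e.hom (DA.frobeniusTwist p n A) DC hDC hDq
  haveI := DualPair.isMonHom_dualIsogenyOver (relFrobeniusHom p n A) DA (DA.frobeniusTwist p n A) hDq hDA
  haveI : IsCommMonObj (DA.frobeniusTwist p n A).hat.X := (DA.frobeniusTwist p n A).hat.isCommMonObj_of_isReduced_base
  haveI := (DA.frobeniusTwist p n A).hat.isMonHom_mulN M₂
  -- the Verschiebung as quasi-inverse of `F`, hence `V^∨` of `F^∨`
  obtain ⟨V, hVmon, hV⟩ := exists_relFrobeniusHom_comp_eq_pow_id p n (A := A)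
  haveI := hVmon
  have hχ := dualIsogenyOver_comp_dualIsogenyOver_eq_pow_id (relFrobeniusHom p n A) V DA (DA.frobeniusTwist p n A) hDq
    (comp_relFrobeniusHom_eq_pow_id_of p n V hV)
  refine comp_lam_comp_dualIsogenyOver_eq_of_pullback_eq (relFrobeniusHom p n A) DA DC (DA.frobeniusTwist p n A) e lamC
    (baseChangeHom (A := (AbelianScheme.ofAbelianVariety A).toOver) (B := DA.hat) lamA (frobSpec k p n) ≫ (DA.frobeniusTwist p n A).hat.mulN M₂)
    (DualPair.dualIsogenyOver V (DA.frobeniusTwist p n A) DA) (pow_ne_zero n (Nat.Prime.pos Fact.out).ne') hχ ?_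
  -- both pull-backs along `F` are `λ_A ≫ [M′] = λ_A ≫ [pⁿ·M₂]`
  have hF := relFrobeniusHom_comp_baseChangeHom_comp_dualIsogenyOver p n A DA hDA lamA
  have hL : relFrobeniusHom p n A ≫
      (baseChangeHom (A := (AbelianScheme.ofAbelianVariety A).toOver) (B := DA.hat) lamA (frobSpec k p n) ≫ (DA.frobeniusTwist p n A).hat.mulN M₂) ≫
        DualPair.dualIsogenyOver (relFrobeniusHom p n A) DA (DA.frobeniusTwist p n A) = lamA ≫ DA.hat.mulN M' := by
    simp only [Category.assoc]
    rw [(DA.frobeniusTwist p n A).hat.mulN_def M₂,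
      ← comp_pow_id_eq_pow_id_comp (DA.frobeniusTwist p n A).hat (DualPair.dualIsogenyOver (relFrobeniusHom p n A) DA (DA.frobeniusTwist p n A)) M₂,
      reassoc_of% hF, ← DA.hat.mulN_def M₂, mulN_comp_mulN DA.hat, ← hM']
  have hR : (relFrobeniusHom p n A ≫ e.hom) ≫ lamC ≫ DualPair.dualIsogenyOver (relFrobeniusHom p n A ≫ e.hom) DA DC = lamA ≫ DA.hat.mulN M' := by
    rw [DualPair.dualIsogenyOver_congr DA DC (ψ₁ := relFrobeniusHom p n A ≫ e.hom) (ψ₂ := φ) (h₂ := inferInstance) he, he, hφ]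
  rw [hL, hR]

set_option backward.isDefEq.respectTransparency false in
/-- **Exact case `M′ = pⁿ`**: `φ ≫ λ_C ≫ φ^∨ = λ_A ≫ [pⁿ]` and `F ≫ e = φ` ⇒ **`e ≫ λ_C ≫ e^∨ = λ_A^{(q)}`** — `e` is an isomorphism of polarised abelian
`k`-schemes `(A^{(q)}, λ^{(q)}) ≅ (C, λ_C)`. [cite: MumfordAV1970, §23 (p. 231)] [cite: Shimura1998, §13.1 Thm. 1 (pp. 97–99)] -/
theorem comp_lam_comp_dualIsogenyOver_eq_baseChangeHom_of_relFrobeniusHom_comp_eq (he : relFrobeniusHom p n A ≫ e.hom = φ)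
    (hφ : φ ≫ lamC ≫ DualPair.dualIsogenyOver φ DA DC = lamA ≫ DA.hat.mulN (p ^ n)) :
    e.hom ≫ lamC ≫ DualPair.dualIsogenyOver e.hom (DA.frobeniusTwist p n A) DC =
      baseChangeHom (A := (AbelianScheme.ofAbelianVariety A).toOver) (B := DA.hat) lamA (frobSpec k p n) := by
  have h := comp_lam_comp_dualIsogenyOver_eq_baseChangeHom_comp_mulN_of_relFrobeniusHom_comp_eq p n φ e DA hDA lamA DC hDC lamC he
    (M₂ := 1) hφ (by rw [mul_one])
  rw [h, (DA.frobeniusTwist p n A).hat.mulN_def 1, pow_one]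
  exact Category.comp_id _

end Recognition

/-! ## §2 The pull-back scalar of a two-step `φ = ρ′ ≫ χ` -/

section TwoStep

variable {S : Scheme.{u}} [IsReduced S] [IsLocallyNoetherian S] {A B C : AbelianSchemeOver S} (ρ' : A.X ⟶ B.X) (χ : B.X ⟶ C.X) [IsMonHom ρ']
  [IsMonHom χ] (DA : A.DualPair) (DB : B.DualPair) (DC : C.DualPair)
  (hDA : Nonempty ((Scheme.Modules.pullback (DualPair.unitHatSlice DA)).obj DA.P ≅ SheafOfModules.unit _))
  (hDB : Nonempty ((Scheme.Modules.pullback (DualPair.unitHatSlice DB)).obj DB.P ≅ SheafOfModules.unit _))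
  (lamA : A.X ⟶ DA.hat.X) (lamB : B.X ⟶ DB.hat.X) (lamC : C.X ⟶ DC.hat.X)

include hDA hDB in
/-- **`(ρ′ ≫ χ) ≫ λ_C ≫ (ρ′ ≫ χ)^∨ = λ_A ≫ [M₁·M₃]`** from `ρ′ ≫ λ_B ≫ ρ′^∨ = λ_A ≫ [M₁]` and `χ ≫ λ_C ≫ χ^∨ = λ_B ≫ [M₃]` (★ `dualIsogenyOver_comp`; the
homomorphism `ρ′^∨` commutes with `[M₃]`). Model: `ρ′` the Hecke datum (descent of `p·λ`), `χ` the Serre cover `B ⊗ 𝔭⁻¹ → B ⊗ 𝔞⁻¹` with its exact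
normalisation. [cite: MumfordAV1970, §15 Thm. 1 (p. 143)] [cite: RapoportSmithlingZhang2020Diagonal, §4.3 (p. 20), (4.23) (p. 21)] -/
theorem comp_comp_lam_comp_dualIsogenyOver_comp_eq {M₁ M₃ : ℕ} (h1 : ρ' ≫ lamB ≫ DualPair.dualIsogenyOver ρ' DA DB = lamA ≫ DA.hat.mulN M₁)
    (h3 : χ ≫ lamC ≫ DualPair.dualIsogenyOver χ DB DC = lamB ≫ DB.hat.mulN M₃) :
    (ρ' ≫ χ) ≫ lamC ≫ DualPair.dualIsogenyOver (ρ' ≫ χ) DA DC = lamA ≫ DA.hat.mulN (M₁ * M₃) := by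
  haveI := DualPair.isMonHom_dualIsogenyOver ρ' DA DB hDB hDA
  rw [DualPair.dualIsogenyOver_comp ρ' χ DA DB DC]
  simp only [Category.assoc]
  rw [reassoc_of% h3, DB.hat.mulN_def M₃, ← comp_pow_id_eq_pow_id_comp DB.hat (DualPair.dualIsogenyOver ρ' DA DB) M₃, reassoc_of% h1,
    ← DA.hat.mulN_def M₃, mulN_comp_mulN DA.hat]

end TwoStep

end AbelianSchemeOver

end Literature.AlgebraicGeometry.AbelianSchemes

end
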